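import Literature.AlgebraicGeometry.Resolution.EffectiveCartierStalks
import Literature.AlgebraicGeometry.Resolution.MonomialMarkedIdeals
import Literature.AlgebraicGeometry.Resolution.MarkedIdealsHomogenized
import Literature.AlgebraicGeometry.Resolution.CoefficientIdealRestriction
import Literature.AlgebraicGeometry.Resolution.MarkedIdealsRestrict
import HarnessLib

/-!
# Simple normal crossings: saturated centres, strata through them, transversal divisors

Topic: `Literature/AlgebraicGeometry/Resolution`. The GENERIC-FIBRE half of the simple normal
crossings bookkeeping in the spreading-out argument for `SpreadsShapedFromGenericPoint`
(`CanonicalResolutionSpread.lean`; BGMW 2011, Def. 3.1.1 / Def. 3.1.3 (2): the centre `C` has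
simple normal crossings with the boundary `E`). The condition `HasSNCWith E C` of
`MarkedIdeals.lean` does not survive specialization as such; what survives (smoothness over the
base, relative effective Cartier divisors) are the following consequences, PROVED here on any
locally Noetherian scheme `X` with `HasSNCWith E C`, for finite sets `B, T` of members of `E`:

* `satCentre C B = ⋃ₙ (C : (∏_{D ∈ B} D)ⁿ)` — **the centre saturated by the divisors of `B`**:
  the union of the components of `V(C)` to which all members of `B` are transversal
  (`stalkIdeal_satCentre`: at a point of `V(C)` its stalk is `C_x` if no member of `B` through
  `x` has its local equation in `C_x`, and `𝒪_{X,x}` otherwise);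
* `HasSNCWith.hasSNCWith_satCentre`, `HasSNCWith.sup_finsetSup` — `HasSNCWith E (satCentre C B)` and
  `HasSNCWith E (C' ⊔ ∑_{K ∈ T} K)` whenever `HasSNCWith E C'`: the saturated centre cut with
  the stratum `⋂_{K ∈ T} V(K)` is again an admissible centre, hence a REGULAR scheme
  (`HasSNCWith.isRegular_subscheme`, Matsumura 14.2);
* `HasSNCWith.isEffectiveCartier_comap_subschemeι` — **a divisor `D₀ ∈ E` whose local equation
  lies at no point in the stalk of the centre `C'` restricts to an effective Cartier divisor on
  `V(C')`**; in particular (`isEffectiveCartier_comap_subschemeι_satCentre_sup`) every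
  `D₀ ∈ B ∖ T` restricts to an effective Cartier divisor on `V(satCentre C B ⊔ ∑_{K∈T} K)`, and
  (`isEffectiveCartier_comap_subschemeι_finsetSup`) every `D₀ ∈ E ∖ T` on the stratum
  `V(∑_{K∈T} K)`; `HasSNCWith.isEffectiveCartier_of_mem` — the members of `E` are effective
  Cartier divisors.

The Cartier conclusions rest on the stalkwise criterion
`isEffectiveCartier_of_forall_mem_nonZeroDivisors` (`EffectiveCartierStalks.lean`, Stacks 01WS
for locally Noetherian schemes).

## Sources

* E. Bierstone, D. Grigoriev, P. Milman, J. Włodarczyk, arXiv:1206.3090, Def. 3.1.1,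
  Def. 3.1.3 (2). [BierstoneGrigorievMilmanWlodarczyk2011]
* H. Matsumura, *Commutative Ring Theory* (1986), Thm. 14.2, Thm. 14.3. [Matsumura1987]
* The Stacks Project, Tag 01WS (effective Cartier divisors, local description). [StacksProject]
-/

noncomputable section

open CategoryTheory CategoryTheory.Limits AlgebraicGeometry TopologicalSpace IsLocalRing

namespace Literature.AlgebraicGeometry.Resolution

universe u

variable {X : Scheme.{u}}


/-! ## Colon ideals by ideals inside or outside a prime -/

section Colon

variable {R : Type*} [CommRing R]

/-- `(P : Q) = P` for a prime `P` and an ideal `Q ⊄ P`. [folklore] -/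
theorem colon_eq_self_of_isPrime_of_not_le {P Q : Ideal R} (hP : P.IsPrime) (hQ : ¬ Q ≤ P) :
    Submodule.colon P (Q : Set R) = P := by
  refine le_antisymm ?_ ?_
  · intro r hr
    obtain ⟨q, hqQ, hqP⟩ := Set.not_subset.mp hQ
    have h := Submodule.mem_colon.mp hr q hqQ
    rw [smul_eq_mul] at h
    exact (hP.mem_or_mem h).resolve_right hqP
  · intro r hr
    exact Submodule.mem_colon.mpr fun q _ => by
      rw [smul_eq_mul]
      exact P.mul_mem_right q hr

/-- `(P : Q) = R` when `Q ⊆ P`. [folklore] -/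
theorem colon_eq_top_of_le {P Q : Ideal R} (hQ : Q ≤ P) : Submodule.colon P (Q : Set R) = ⊤ :=
  eq_top_iff.mpr fun r _ => Submodule.mem_colon.mpr fun q hq => by
    rw [smul_eq_mul]
    exact P.mul_mem_left r (hQ hq)

/-- `⋃ₙ (P : Qⁿ) = P` for a prime `P` and an ideal `Q ⊄ P`. [folklore] -/
theorem iSup_colon_pow_eq_self_of_isPrime_of_not_le {P Q : Ideal R} (hP : P.IsPrime) (hQ : ¬ Q ≤ P) :
    ⨆ n : ℕ, Submodule.colon P ((Q ^ n : Ideal R) : Set R) = P := by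
  refine le_antisymm (iSup_le fun n => ?_) ?_
  · rw [colon_eq_self_of_isPrime_of_not_le hP]
    intro hle
    rcases Nat.eq_zero_or_pos n with rfl | hn
    · rw [pow_zero, Ideal.one_eq_top, top_le_iff] at hle
      exact hP.ne_top hle
    · exact hQ ((Ideal.IsPrime.pow_le_iff (I := Q) (hP := hP) hn.ne').mp hle)
  · refine le_iSup_of_le 1 ?_
    rw [pow_one, colon_eq_self_of_isPrime_of_not_le hP hQ]

/-- `⋃ₙ (P : Qⁿ) = R` when `Q ⊆ P`. [folklore] -/
theorem iSup_colon_pow_eq_top_of_le {P Q : Ideal R} (hQ : Q ≤ P) :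
    ⨆ n : ℕ, Submodule.colon P ((Q ^ n : Ideal R) : Set R) = ⊤ :=
  top_le_iff.mp (le_iSup_of_le 1 (by rw [pow_one, colon_eq_top_of_le hQ]))

end Colon

/-! ## The centre saturated by a finite set of divisors -/

section SatCentre

open Scheme.IdealSheafData

/-- **The centre `C` saturated by the divisors of `B`**: `⋃ₙ (C : (∏_{D ∈ B} D)ⁿ)` — the ideal
sheaf of the union of those components of `V(C)` which are contained in no member of `B` (under
simple normal crossings: to which every member of `B` through them is transversal,
`HasSNCWith.stalkIdeal_satCentre_eq_top_or`). [folklore] -/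
def satCentre (C : X.IdealSheafData) (B : Finset X.IdealSheafData) : X.IdealSheafData :=
  ⨆ n : ℕ, colon C ((∏ D ∈ B, D) ^ n)

/-- Unfolding. [folklore] -/
theorem satCentre_def (C : X.IdealSheafData) (B : Finset X.IdealSheafData) :
    satCentre C B = ⨆ n : ℕ, colon C ((∏ D ∈ B, D) ^ n) := rfl

/-- `C ⊆ satCentre C B`. [folklore] -/
theorem le_satCentre (C : X.IdealSheafData) (B : Finset X.IdealSheafData) : C ≤ satCentre C B :=
  le_iSup_of_le (f := fun n : ℕ => colon C ((∏ D ∈ B, D) ^ n)) 1 (le_colon_self C _)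

/-- `V(satCentre C B) ⊆ V(C)`. [folklore] -/
theorem support_satCentre_le (C : X.IdealSheafData) (B : Finset X.IdealSheafData) :
    (satCentre C B).support ≤ C.support :=
  support_antitone (le_satCentre C B)

/-- Stalks of a finite product of ideal sheaves. [folklore] -/
theorem stalkIdeal_finsetProd (B : Finset X.IdealSheafData) (x : X) :
    stalkIdeal (∏ D ∈ B, D) x = ∏ D ∈ B, stalkIdeal D x := by
  classical
  induction B using Finset.induction_on with
  | empty =>
    rw [Finset.prod_empty, Finset.prod_empty, one_eq_top, stalkIdeal_top, Ideal.one_eq_top]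
  | insert D B hD ih => rw [Finset.prod_insert hD, Finset.prod_insert hD, stalkIdeal_mul, ih]

/-- **Stalks of the saturated centre** (locally Noetherian): `(satCentre C B)_x = ⋃ₙ (C_x : (∏_{D∈B} D_x)ⁿ)`.
[folklore] -/
theorem stalkIdeal_satCentre [IsLocallyNoetherian X] (C : X.IdealSheafData)
    (B : Finset X.IdealSheafData) (x : X) :
    stalkIdeal (satCentre C B) x =
      ⨆ n : ℕ, Submodule.colon (stalkIdeal C x)
        (((∏ D ∈ B, stalkIdeal D x) ^ n : Ideal (X.presheaf.stalk x)) : Set (X.presheaf.stalk x)) := by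
  rw [satCentre, stalkIdeal_iSup]
  congr 1
  ext n : 1
  rw [stalkIdeal_colon, stalkIdeal_pow, stalkIdeal_finsetProd]

/-- If some member of `B` has its stalk inside `C_x` (e.g. a divisor of `B` containing the
component of `V(C)` through `x`), the saturated centre is the unit ideal at `x`. [folklore] -/
theorem stalkIdeal_satCentre_eq_top_of_le [IsLocallyNoetherian X] (C : X.IdealSheafData)
    {B : Finset X.IdealSheafData} {x : X} {D : X.IdealSheafData} (hD : D ∈ B)
    (hle : stalkIdeal D x ≤ stalkIdeal C x) : stalkIdeal (satCentre C B) x = ⊤ := by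
  rw [stalkIdeal_satCentre]
  refine iSup_colon_pow_eq_top_of_le ((Ideal.prod_le_inf.trans (Finset.inf_le hD)).trans hle)

/-- Off `V(C)` the saturated centre is the unit ideal. [folklore] -/
theorem stalkIdeal_satCentre_eq_top_of_not_mem [IsLocallyNoetherian X] (C : X.IdealSheafData)
    (B : Finset X.IdealSheafData) {x : X} (hx : x ∉ C.support) :
    stalkIdeal (satCentre C B) x = ⊤ := by
  rw [stalkIdeal_satCentre, stalkIdeal_eq_top_of_not_mem_support hx]
  exact top_le_iff.mp (le_iSup_of_le 1 (by rw [colon_eq_top_of_le le_top]))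

/-- **At a point of `V(C)` where `C_x` is prime and no member of `B` through `x` has its stalk
inside `C_x`, the saturated centre has stalk `C_x`.** [folklore] -/
theorem stalkIdeal_satCentre_eq_of_forall_not_le [IsLocallyNoetherian X] {C : X.IdealSheafData}
    {B : Finset X.IdealSheafData} {x : X} (hprime : (stalkIdeal C x).IsPrime)
    (htr : ∀ D ∈ B, x ∈ D.support → ¬ stalkIdeal D x ≤ stalkIdeal C x) :
    stalkIdeal (satCentre C B) x = stalkIdeal C x := by
  rw [stalkIdeal_satCentre]
  refine iSup_colon_pow_eq_self_of_isPrime_of_not_le hprime fun hle => ?_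
  obtain ⟨D, hDB, hDle⟩ := (Ideal.IsPrime.prod_le hprime).mp hle
  by_cases hxD : x ∈ D.support
  · exact htr D hDB hxD hDle
  · rw [stalkIdeal_eq_top_of_not_mem_support hxD, top_le_iff] at hDle
    exact hprime.ne_top hDle

/-- **The stalks of the saturated centre under simple normal crossings**: either the unit ideal,
or `x ∈ V(C)`, every member of `B` through `x` is transversal to `C` at `x` (its local equation is
not in `C_x`) and the stalk is `C_x`. [folklore] -/
theorem HasSNCWith.stalkIdeal_satCentre_eq_top_or [IsLocallyNoetherian X] {E : List X.IdealSheafData}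
    {C : X.IdealSheafData} (h : HasSNCWith E C) (B : Finset X.IdealSheafData) (x : X) :
    stalkIdeal (satCentre C B) x = ⊤ ∨
      (x ∈ C.support ∧ (∀ D ∈ B, x ∈ D.support → ¬ stalkIdeal D x ≤ stalkIdeal C x) ∧
        stalkIdeal (satCentre C B) x = stalkIdeal C x) := by
  classical
  by_cases hx : x ∈ C.support
  · by_cases htr : ∀ D ∈ B, x ∈ D.support → ¬ stalkIdeal D x ≤ stalkIdeal C x
    · refine Or.inr ⟨hx, htr, stalkIdeal_satCentre_eq_of_forall_not_le ?_ htr⟩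
      obtain ⟨hreg, u, hu, S, hS⟩ := h.isRsopGeneratedAt hx
      haveI := hreg
      rw [hS, ← S.toFinite.coe_toFinset]
      exact isPrime_span_image rfl u hu _
    · push Not at htr
      obtain ⟨D, hDB, -, hle⟩ := htr
      exact Or.inl (stalkIdeal_satCentre_eq_top_of_le C hDB hle)
  · exact Or.inl (stalkIdeal_satCentre_eq_top_of_not_mem C B hx)

/-- A point lies in the support of an ideal sheaf iff the stalk is a proper ideal. [folklore] -/
theorem mem_support_iff_stalkIdeal_ne_top (I : X.IdealSheafData) (x : X) :
    x ∈ I.support ↔ stalkIdeal I x ≠ ⊤ := by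
  rw [mem_support_iff_stalkIdeal_le]
  constructor
  · intro h htop
    rw [htop, top_le_iff] at h
    exact (maximalIdeal.isMaximal _).ne_top h
  · exact IsLocalRing.le_maximalIdeal

/-- **The saturated centre is again an admissible centre for `E`**: `HasSNCWith E C` implies
`HasSNCWith E (satCentre C B)` (at its points the stalk is `C_x`, generated by the same
parameters). [cite: BierstoneGrigorievMilmanWlodarczyk2011, Def. 3.1.3 (2)] -/
theorem HasSNCWith.hasSNCWith_satCentre [IsLocallyNoetherian X] {E : List X.IdealSheafData}
    {C : X.IdealSheafData} (h : HasSNCWith E C) (B : Finset X.IdealSheafData) :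
    HasSNCWith E (satCentre C B) := by
  intro x
  obtain ⟨hreg, u, hu, hE, hC⟩ := h x
  refine ⟨hreg, u, hu, hE, fun hx => ?_⟩
  rcases h.stalkIdeal_satCentre_eq_top_or B x with htop | ⟨hxC, -, heq⟩
  · exact absurd htop ((mem_support_iff_stalkIdeal_ne_top _ x).mp hx)
  · rw [heq]
    exact hC hxC

/-- **Cutting an admissible centre with a stratum of the boundary gives an admissible centre**:
if `HasSNCWith E C'` and `T` consists of members of `E` then `HasSNCWith E (C' ⊔ ∑_{K∈T} K)` —
at a point of `V(C') ∩ ⋂_{K∈T} V(K)` the stalk is generated by the parameters of `C'` and those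
attached to the members of `T` (cf. `HasSNC.hasSNCWith_finsetSup` for `C' = 𝒪`).
[cite: BierstoneGrigorievMilmanWlodarczyk2011, Def. 3.1.3 (2)] -/
theorem HasSNCWith.sup_finsetSup {E : List X.IdealSheafData} {C' : X.IdealSheafData}
    (h : HasSNCWith E C') (T : Finset X.IdealSheafData) (hT : ∀ K ∈ T, K ∈ E) :
    HasSNCWith E (C' ⊔ T.sup id) := by
  classical
  intro x
  obtain ⟨hreg, u, hu, ⟨ι, hιinj, hι⟩, hC⟩ := h x
  refine ⟨hreg, u, hu, ⟨ι, hιinj, hι⟩, fun hx => ?_⟩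
  have hx' : x ∈ C'.support ⊓ (T.sup id).support := by rwa [← support_sup]
  obtain ⟨hxC, hxT'⟩ := hx'
  have hxT : ∀ K ∈ T, x ∈ K.support := (mem_support_finsetSup_iff T x).mp hxT'
  obtain ⟨S, hS⟩ := hC hxC
  refine ⟨S ∪ (fun K : T => ι ⟨K.1, hT K.1 K.2, hxT K.1 K.2⟩) '' Set.univ, ?_⟩
  have h1 : (T.sup fun K => stalkIdeal K x) =
      T.attach.sup fun K : T => Ideal.span {u (ι ⟨K.1, hT K.1 K.2, hxT K.1 K.2⟩)} := by
    rw [← Finset.sup_attach]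
    exact Finset.sup_congr rfl fun K _ => hι ⟨K.1, hT K.1 K.2, hxT K.1 K.2⟩
  rw [stalkIdeal_sup, hS, stalkIdeal_finsetSup, h1, Finset.sup_span_singleton_eq_span_image,
    Finset.coe_attach, Set.image_union, Ideal.span_union, Set.image_image]

/-- The saturated centre cut with a stratum is a regular scheme. [cite: Matsumura1987, Thm. 14.2] -/
theorem HasSNCWith.isRegular_subscheme_satCentre_sup [IsLocallyNoetherian X]
    {E : List X.IdealSheafData} {C : X.IdealSheafData} (h : HasSNCWith E C)
    (B T : Finset X.IdealSheafData) (hT : ∀ K ∈ T, K ∈ E) :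
    Scheme.IsRegular (satCentre C B ⊔ T.sup id).subscheme :=
  ((h.hasSNCWith_satCentre B).sup_finsetSup T hT).isRegular_subscheme

/-- A stratum of the boundary is a regular scheme. [cite: Matsumura1987, Thm. 14.2] -/
theorem HasSNCWith.isRegular_subscheme_finsetSup [IsLocallyNoetherian X]
    {E : List X.IdealSheafData} {C : X.IdealSheafData} (h : HasSNCWith E C)
    (T : Finset X.IdealSheafData) (hT : ∀ K ∈ T, K ∈ E) :
    Scheme.IsRegular (T.sup id).subscheme :=
  h.hasSNC.isRegular_subscheme_finsetSup T hT

end SatCentre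

/-! ## Pull-backs of saturated centres and strata -/

section Comap

open Scheme.IdealSheafData

variable {X' : Scheme.{u}} (f : X' ⟶ X)

/-- Inverse images commute with finite products of ideal sheaves. [folklore] -/
theorem comap_finsetProd (B : Finset X.IdealSheafData) :
    (∏ D ∈ B, D).comap f = ∏ D ∈ B, D.comap f := by
  classical
  induction B using Finset.induction_on with
  | empty => rw [Finset.prod_empty, Finset.prod_empty, one_eq_top, comap_top, one_eq_top]
  | insert D B hD ih => rw [Finset.prod_insert hD, Finset.prod_insert hD, comap_mul, ih]

/-- Inverse images commute with finite sums of ideal sheaves: `f^*(∑_{K∈T} K) = ∑_{K∈T} f^*K`.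
[folklore] -/
theorem comap_finsetSup [DecidableEq X'.IdealSheafData] (T : Finset X.IdealSheafData) :
    (T.sup id).comap f = (T.image fun K => K.comap f).sup id := by
  classical
  induction T using Finset.induction_on with
  | empty => rw [Finset.sup_empty, Finset.image_empty, Finset.sup_empty, (map_gc f).l_bot]
  | insert K T hK ih =>
    rw [Finset.sup_insert, Finset.image_insert, Finset.sup_insert, id, id, (map_gc f).l_sup, ih]

/-- **Saturated centres commute with flat base change** between locally Noetherian schemes
(colon ideal sheaves do, `comap_colon_of_flat`): `f^*(satCentre C B) = ⋃ₙ (f^*C : (∏_{D∈B} f^*D)ⁿ)`.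
[cite: Matsumura1987, Thm. 7.4 (iii)] -/
theorem comap_satCentre_of_flat [Flat f] [IsLocallyNoetherian X] [IsLocallyNoetherian X']
    (C : X.IdealSheafData) (B : Finset X.IdealSheafData) :
    (satCentre C B).comap f = ⨆ n : ℕ, colon (C.comap f) ((∏ D ∈ B, D.comap f) ^ n) := by
  rw [satCentre, (map_gc f).l_iSup]
  congr 1
  funext n
  rw [comap_colon_of_flat, comap_pow, comap_finsetProd]

/-- … and, when `f^*` is injective on `B`, `f^*(satCentre C B) = satCentre (f^*C) (f^*B)`.
[cite: Matsumura1987, Thm. 7.4 (iii)] -/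
theorem comap_satCentre_of_flat_of_injOn [Flat f] [IsLocallyNoetherian X] [IsLocallyNoetherian X']
    [DecidableEq X'.IdealSheafData] (C : X.IdealSheafData) (B : Finset X.IdealSheafData)
    (hinj : Set.InjOn (fun D : X.IdealSheafData => D.comap f) B) :
    (satCentre C B).comap f = satCentre (C.comap f) (B.image fun D => D.comap f) := by
  rw [comap_satCentre_of_flat, satCentre, Finset.prod_image hinj]

end Comap

/-! ## Divisors transversal to a centre restrict to effective Cartier divisors on it -/

section Transversal

open Scheme.IdealSheafData

/-- **A boundary divisor whose local equation lies at no point in the stalk of the centre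
restricts to an effective Cartier divisor on the centre.** Let `HasSNCWith E C'`, `D₀ ∈ E`, and
suppose `(D₀)_x ⊄ C'_x` at every `x ∈ V(C') ∩ V(D₀)`. Then `D₀ · 𝒪_{V(C')}` is an effective
Cartier divisor on `V(C')`: at a point `s` over `x`, `𝒪_{V(C'),s} = 𝒪_{X,x}/C'_x` is a domain
(`C'_x` is generated by part of a regular system of parameters) in which the image of the
parameter `u_{D₀}` is non-zero. [cite: Matsumura1987, Thm. 14.2 and Thm. 14.3] -/
theorem HasSNCWith.isEffectiveCartier_comap_subschemeι [IsLocallyNoetherian X]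
    {E : List X.IdealSheafData} {C' : X.IdealSheafData} (h : HasSNCWith E C')
    {D₀ : X.IdealSheafData} (hD₀ : D₀ ∈ E)
    (hnot : ∀ x ∈ C'.support, x ∈ D₀.support → ¬ stalkIdeal D₀ x ≤ stalkIdeal C' x) :
    IsEffectiveCartier (D₀.comap C'.subschemeι) := by
  haveI : IsLocallyNoetherian C'.subscheme := LocallyOfFiniteType.isLocallyNoetherian C'.subschemeι
  refine isEffectiveCartier_of_forall_mem_nonZeroDivisors fun s hs => ?_
  have hxC : C'.subschemeι s ∈ C'.support := subschemeι_apply_mem_support C' s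
  have hxD : C'.subschemeι s ∈ D₀.support := by
    rw [support_comap] at hs
    exact hs
  obtain ⟨hreg, u, hu, ⟨ι, hιinj, hι⟩, hC⟩ := h (C'.subschemeι s)
  haveI := hreg
  obtain ⟨S, hS⟩ := hC hxC
  set k := ι ⟨D₀, hD₀, hxD⟩ with hk
  have hkS : k ∉ S := by
    intro hkS
    refine hnot _ hxC hxD ?_
    rw [hι ⟨D₀, hD₀, hxD⟩, hS]
    exact Ideal.span_mono (Set.singleton_subset_iff.mpr ⟨k, hkS, rfl⟩)
  -- the stalk of the restricted divisor is generated by the image of `u_k`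
  set φ := (C'.subschemeι.stalkMap s).hom with hφ
  refine ⟨φ (u k), ?_, ?_⟩
  · -- `𝒪_{V,s} ≅ 𝒪_{X,x} / C'_x` is a domain and `u_k ∉ C'_x`
    have hsurj : Function.Surjective φ := C'.subschemeι.stalkMap_surjective s
    have hker : RingHom.ker φ = stalkIdeal C' (C'.subschemeι s) := ker_stalkMap_subschemeι C' s
    haveI hprime : (RingHom.ker φ).IsPrime := by
      rw [hker, hS, ← S.toFinite.coe_toFinset]
      exact isPrime_span_image rfl u hu _
    haveI : IsDomain (X.presheaf.stalk (C'.subschemeι s) ⧸ RingHom.ker φ) :=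
      Ideal.Quotient.isDomain _
    have hne : Ideal.Quotient.mk (RingHom.ker φ) (u k) ≠ 0 := by
      rw [Ne, Ideal.Quotient.eq_zero_iff_mem, hker, hS]
      exact not_mem_span_image_of_not_mem rfl u hu hkS
    let e := RingHom.quotientKerEquivOfSurjective hsurj
    refine mem_nonZeroDivisors_of_map_ringEquiv e.symm ?_
    have he : e.symm (φ (u k)) = Ideal.Quotient.mk (RingHom.ker φ) (u k) := by
      apply e.injective
      rw [RingEquiv.apply_symm_apply]
      rfl
    rw [he]
    exact mem_nonZeroDivisors_of_ne_zero hne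
  · rw [stalkIdeal_comap_eq_map_stalkMap, hι ⟨D₀, hD₀, hxD⟩, Ideal.map_span, Set.image_singleton]

/-- **The members of `B ∖ T` restrict to effective Cartier divisors on
`V(satCentre C B ⊔ ∑_{K∈T} K)`** (`B, T ⊆ E`, `HasSNCWith E C`): at a point of that subscheme
every member of `B` through it is transversal to `C` (`HasSNCWith.stalkIdeal_satCentre_eq_top_or`) and a
member outside `T` carries a parameter different from those of `T`.
[cite: BierstoneGrigorievMilmanWlodarczyk2011, Def. 3.1.3 (2)] -/
theorem HasSNCWith.isEffectiveCartier_comap_subschemeι_satCentre_sup [IsLocallyNoetherian X]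
    {E : List X.IdealSheafData} {C : X.IdealSheafData} (h : HasSNCWith E C)
    (B T : Finset X.IdealSheafData) (hT : ∀ K ∈ T, K ∈ E) {D₀ : X.IdealSheafData}
    (hD₀E : D₀ ∈ E) (hD₀B : D₀ ∈ B) (hD₀T : D₀ ∉ T) :
    IsEffectiveCartier (D₀.comap (satCentre C B ⊔ T.sup id).subschemeι) := by
  classical
  refine ((h.hasSNCWith_satCentre B).sup_finsetSup T hT).isEffectiveCartier_comap_subschemeι hD₀E
    fun x hx hxD hle => ?_
  have hx' : x ∈ (satCentre C B).support ⊓ (T.sup id).support := by rwa [← support_sup]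
  obtain ⟨hxsat, hxT'⟩ := hx'
  have hxT : ∀ K ∈ T, x ∈ K.support := (mem_support_finsetSup_iff T x).mp hxT'
  rcases h.stalkIdeal_satCentre_eq_top_or B x with htop | ⟨hxC, htr, heq⟩
  · exact (mem_support_iff_stalkIdeal_ne_top _ x).mp hxsat htop
  obtain ⟨hreg, u, hu, ⟨ι, hιinj, hι⟩, hC⟩ := h x
  haveI := hreg
  obtain ⟨S, hS⟩ := hC hxC
  set k := ι ⟨D₀, hD₀E, hxD⟩ with hk
  -- `u_k` is neither a parameter of `C` (transversality) nor one of `T` (injectivity)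
  have hkS : k ∉ S := by
    intro hkS
    refine htr D₀ hD₀B hxD ?_
    rw [hι ⟨D₀, hD₀E, hxD⟩, hS]
    exact Ideal.span_mono (Set.singleton_subset_iff.mpr ⟨k, hkS, rfl⟩)
  have hkT : k ∉ (fun K : T => ι ⟨K.1, hT K.1 K.2, hxT K.1 K.2⟩) '' Set.univ := by
    rintro ⟨K, -, hK⟩
    have hKD : (⟨K.1, hT K.1 K.2, hxT K.1 K.2⟩ : {D : X.IdealSheafData // D ∈ E ∧ x ∈ D.support}) =
        ⟨D₀, hD₀E, hxD⟩ := hιinj hK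
    have hKD' : K.1 = D₀ := congrArg Subtype.val hKD
    exact hD₀T (hKD' ▸ K.2)
  have h1 : (T.sup fun K => stalkIdeal K x) =
      T.attach.sup fun K : T => Ideal.span {u (ι ⟨K.1, hT K.1 K.2, hxT K.1 K.2⟩)} := by
    rw [← Finset.sup_attach]
    exact Finset.sup_congr rfl fun K _ => hι ⟨K.1, hT K.1 K.2, hxT K.1 K.2⟩
  have hstalk : stalkIdeal (satCentre C B ⊔ T.sup id) x =
      Ideal.span (u '' (S ∪ (fun K : T => ι ⟨K.1, hT K.1 K.2, hxT K.1 K.2⟩) '' Set.univ)) := by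
    rw [stalkIdeal_sup, heq, hS, stalkIdeal_finsetSup, h1, Finset.sup_span_singleton_eq_span_image,
      Finset.coe_attach, Set.image_union, Ideal.span_union, Set.image_image]
  have hk' : k ∉ S ∪ (fun K : T => ι ⟨K.1, hT K.1 K.2, hxT K.1 K.2⟩) '' Set.univ := by
    rintro (h1 | h2)
    · exact hkS h1
    · exact hkT h2
  refine not_mem_span_image_of_not_mem rfl u hu hk' ?_
  rw [hι ⟨D₀, hD₀E, hxD⟩, hstalk, Ideal.span_singleton_le_iff_mem] at hle
  exact hle

/-- **The members of `E ∖ T` restrict to effective Cartier divisors on the stratum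
`V(∑_{K∈T} K)`.** [cite: BierstoneGrigorievMilmanWlodarczyk2011, Def. 3.1.1] -/
theorem HasSNCWith.isEffectiveCartier_comap_subschemeι_finsetSup [IsLocallyNoetherian X]
    {E : List X.IdealSheafData} {C : X.IdealSheafData} (h : HasSNCWith E C)
    (T : Finset X.IdealSheafData) (hT : ∀ K ∈ T, K ∈ E) {D₀ : X.IdealSheafData}
    (hD₀E : D₀ ∈ E) (hD₀T : D₀ ∉ T) :
    IsEffectiveCartier (D₀.comap (T.sup id).subschemeι) := by
  classical
  refine (h.hasSNC.hasSNCWith_finsetSup T hT).isEffectiveCartier_comap_subschemeι hD₀E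
    fun x hx hxD hle => ?_
  rw [mem_support_finsetSup_iff] at hx
  obtain ⟨hreg, u, hu, ⟨ι, hιinj, hι⟩, -⟩ := h x
  haveI := hreg
  set k := ι ⟨D₀, hD₀E, hxD⟩ with hk
  have hkT : k ∉ (fun K : T => ι ⟨K.1, hT K.1 K.2, hx K.1 K.2⟩) '' Set.univ := by
    rintro ⟨K, -, hK⟩
    have hKD : (⟨K.1, hT K.1 K.2, hx K.1 K.2⟩ : {D : X.IdealSheafData // D ∈ E ∧ x ∈ D.support}) =
        ⟨D₀, hD₀E, hxD⟩ := hιinj hK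
    have hKD' : K.1 = D₀ := congrArg Subtype.val hKD
    exact hD₀T (hKD' ▸ K.2)
  have h1 : (T.sup fun K => stalkIdeal K x) =
      T.attach.sup fun K : T => Ideal.span {u (ι ⟨K.1, hT K.1 K.2, hx K.1 K.2⟩)} := by
    rw [← Finset.sup_attach]
    exact Finset.sup_congr rfl fun K _ => hι ⟨K.1, hT K.1 K.2, hx K.1 K.2⟩
  have hstalk : stalkIdeal (T.sup id) x =
      Ideal.span (u '' ((fun K : T => ι ⟨K.1, hT K.1 K.2, hx K.1 K.2⟩) '' Set.univ)) := by
    rw [stalkIdeal_finsetSup, h1, Finset.sup_span_singleton_eq_span_image, Finset.coe_attach,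
      Set.image_image]
  refine not_mem_span_image_of_not_mem rfl u hu (i := k) hkT ?_
  rw [hι ⟨D₀, hD₀E, hxD⟩, hstalk, Ideal.span_singleton_le_iff_mem] at hle
  exact hle

/-- **The members of a boundary with simple normal crossings are effective Cartier divisors**
(their stalks are generated by members of regular systems of parameters, non-zero in the regular
local rings `𝒪_{X,x}`). [cite: BierstoneGrigorievMilmanWlodarczyk2011, Def. 3.1.1] -/
theorem HasSNCWith.isEffectiveCartier_of_mem [IsLocallyNoetherian X] {E : List X.IdealSheafData}
    {C : X.IdealSheafData} (h : HasSNCWith E C) {D : X.IdealSheafData} (hD : D ∈ E) :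
    IsEffectiveCartier D :=
  isEffectiveCartier_of_forall_mem_nonZeroDivisors fun x hx => by
    obtain ⟨hreg, u, hu, ⟨ι, -, hι⟩, -⟩ := h x
    haveI := hreg
    haveI := isDomain_of_isRegularLocalRing (X.presheaf.stalk x)
    have hrsop : IsRsopPart (u ∘ id) := isRsopPart_comp_of_rsop rfl u hu id Function.injective_id
    exact ⟨u (ι ⟨D, hD, hx⟩), mem_nonZeroDivisors_of_ne_zero (hrsop.ne_zero (ι ⟨D, hD, hx⟩)),
      hι ⟨D, hD, hx⟩⟩

end Transversal

end Literature.AlgebraicGeometry.Resolution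

end
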